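import Literature.Geometry.Lorentzian.KerrNullShearFree
import Literature.Geometry.Lorentzian.KerrHawkingField
import Literature.Geometry.Lorentzian.KerrAxialSymmetry
import Literature.Geometry.Lorentzian.KerrSurfaceGravity
import HarnessLib

/-!
# The bulk term of the red-shift multiplier on Kerr, exactly: `K^{ℓ♯}`, `K^{K} = 0` for the
# Hawking Killing field, and `K^N` for `N = (1 + h₁(r − r₊)) K + (1 + f₁(r − r₊)) k`

(family `gr`; infrastructure for statement **gr.S24** — the red-shift vector field of
Dafermos–Rodnianski–Shlapentokh-Rothman, arXiv:1402.7034, Prop. 4.5.1, in the coefficient-field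
framework of `KerrSchild.multiplierBulk`; namespace `Literature.Geometry.Lorentzian.Kerr`)

Dafermos–Rodnianski–Shlapentokh-Rothman (arXiv:1402.7034 = Ann. of Math. 183 (2016), §4.5,
Prop. 4.5.1) recall from Dafermos–Rodnianski (*Lectures on black holes and linear waves*,
arXiv:0811.0354, §3.3.2 and Thm. 7.1) the red-shift vector field `N`: a `φ_τ`-invariant timelike
vector field with `K^N ≥ b J^N_μ N^μ` near the event horizon of a sub-extremal black hole, the
positivity coming from the surface gravity `κ > 0`. Their explicit Schwarzschild recipe
(arXiv:0811.0354, §3.3.2) is `N = T + Y`, `Y = (1 + δ₁(r − 2M)) Ŷ + δ₂(r − 2M) T` with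
`Ŷ = (1 − 2M/r)⁻¹ ∂_u` the regular ingoing null vector. On Kerr, in the ingoing Kerr–Schild chart
of `KerrSchild.lean`, the same recipe reads
`N = (1 + h₁(r − r₊)) K + (1 + f₁(r − r₊)) k`,
with `K = T + ω₊ Φ` the Hawking Killing field (`Kerr.hawkingVector`, the null generator of `𝓗⁺`)
in place of `T`, and `k = −ℓ♯ = ∂_{t*} − ℓ⃗·∇` the future-directed ingoing principal null vector
(`KerrNullFrame.lean`) in place of `Ŷ`. This file computes its bulk term
`K^N = T_{μν}∇^μN^ν` (`KerrSchild.multiplierBulk` for `g⁻¹_{M,a} = Kerr.inverseMetric M a`)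
**exactly**, as a quadratic form in `p = dw`:

* `Kerr.multiplierBulk_nullVector` — **`K^{ℓ♯} = (r/Σ) u v + (∂_{ℓ♯}H) v²`** (`u = p(m)`,
  `v = p(k)` the frame functionals of `KerrNullFrame.lean`): the shear form `𝒟(p, p)` of the first
  piece is `(r/Σ)|p̸|²` by shear-freeness (`KerrNullShearFree.lean`) and cancels against the
  expansion piece `−½ (2r/Σ) g⁻¹(p, p) = −(r/Σ)(−uv + |p̸|²)`; the derivative piece is
  `(∂_{ℓ♯}H) v²` by geodesy. For `k = −ℓ♯` the coefficient of `(kψ)² = v²` in `K^k = −K^{ℓ♯}` is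
  `−∂_{ℓ♯}H = M(r² − a²cos²θ)/Σ² > 0`: the red-shift.
* `Kerr.fderiv_axialVector_eq_zero_of_invariant`, `Kerr.hasDerivAt_axialRotation` — the axial
  rotations `R_α` of `KerrAxialSymmetry.lean` have velocity `Φ = x₁∂₂ − x₂∂₁` (`Kerr.axialVector`)
  at `α = 0`, so every `R_α`-invariant function has `∂_Φ F = 0`: `∂_Φ r = ∂_Φ H = 0`, and the
  equivariant null vector has `∂_Φ ℓ♯ = Φ(ℓ♯) = (0, −ℓ₂, ℓ₁, 0)` (`Kerr.fderiv_nullVector_apply_axialVector`).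
* `Kerr.multiplierBulk_axialVector`, `Kerr.multiplierBulk_timeTranslation`,
  **`Kerr.multiplierBulk_hawkingVector`** — `K^Φ = 0`, `K^T = 0`, `K^K = 0`: the deformation
  tensors of the Killing fields vanish, here as identities of the coordinate formula (stationarity
  `∂_{t*} g⁻¹ = 0` and the infinitesimal axisymmetry `∂_Φ g^{αβ} = 4H v p(Φℓ♯)`-bookkeeping).
* `Kerr.redShiftVector M a h₁ f₁` — the components of `N`, and
  **`Kerr.multiplierBulk_redShiftVector`** — for `r > 0`:
  `K^N = h₁ g⁻¹(p, dr) p(K) + f₁ (g⁻¹(p, dr) v + ½ g⁻¹(p, p)) − (1 + f₁(r − r₊)) ((r/Σ) u v + (∂_{ℓ♯}H) v²)`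
  (`KerrSchild.multiplierBulk_add/_smul` with `K(r) = 0`, `k(r) = −1`, `K^K = 0`, `K^k = −K^{ℓ♯}`).

* Frame identities: `|∇̸r|² = (r² + a² − Σ)/Σ` (`Kerr.frameAngSq_dRadius`), `g⁻¹(dr, dr) = Δ/Σ`
  (`Kerr.raisedDotRadius_dRadius`), and the `f₁`-terms as a square up to `Δ`,
  `g⁻¹(p, dr) v + ½ g⁻¹(p, p) = ½ |p̸ + v∇̸r|² − ½ (Δ/Σ) v²` (`Kerr.raisedDotRadius_mul_frameIn_add`).
* On the horizon `r = r₊` (`|a| ≤ M`, `0 < M`): **`dr♯ = 2H K`** (`Kerr.raisedDotRadius_of_radius_eq_rPlus`: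
  the normal of the null hypersurface `{r = r₊}` is the null generator), `g⁻¹(dr, dr) = 0`,
  `1 − 2H = −|∇̸r|²`, and the **red-shift coefficient** `−∂_{ℓ♯}H − (r/Σ)|∇̸r|² = (r₊ − M)/Σ`
  (`Kerr.redShiftCoeff_of_radius_eq_rPlus`; `= 2H κ`, `κ = (r₊ − M)/(2Mr₊)` the surface gravity).
* **`Kerr.multiplierBulk_redShiftVector_of_radius_eq_rPlus`** — the horizon form
  `K^N|_{𝓗⁺} = 2H h₁ λ² + ½ f₁ |q̸|² + ((r₊ − M)/Σ) v² − (4Hr₊/Σ) λ v + (2r₊/Σ) v (q̸·∇̸r)`,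
  `λ = p(K)`, `q = p + v dr`: positive `v²`-coefficient from `κ > 0`, the squares of the other two
  components bought by `h₁`, `f₁`, bounded cross terms — the structure of Dafermos–Rodnianski,
  arXiv:0811.0354, Thm. 7.1, on the Kerr horizon.

The positivity of the horizon form for large `f₁`, `h₁`, its propagation to a neighbourhood of `𝓗⁺`
by compactness, and the red-shift estimate proper are in the sequel files. All statements are
pointwise identities; no named facts are introduced (D-0026).

## References

* M. Dafermos, I. Rodnianski, Y. Shlapentokh-Rothman, *Decay for solutions of the wave equation on
  Kerr exterior spacetimes III*, arXiv:1402.7034 = Ann. of Math. 183 (2016), §2.2.2 (`T`, `Φ`,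
  `K = T + ω₊Φ`), §2.3.1 (`K^V`), §4.5, Prop. 4.5.1 (the red-shift vector field)
  (key `DafermosRodnianskiShlapentokhrothman2014`).
* M. Dafermos, I. Rodnianski, *Lectures on black holes and linear waves*, arXiv:0811.0354, §3.3.2
  (the explicit `N`, `Y`, `Ŷ`), §7.1, Thm. 7.1 (general Killing horizons with `κ > 0`), App. D
  (key `DafermosRodnianski2008`).
* R. P. Kerr, A. Schild, 1965, §2 (key `KerrSchild1965`).
-/

noncomputable section

open Set Filter
open scoped Topology

namespace Literature.Geometry.Lorentzian.Kerr

variable {M a : ℝ} {x : E4}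

/-! ### The bulk term of the principal null vector `ℓ♯` -/

/-- **The bulk term of the principal null vector on Kerr**, exactly: at a point with `r > 0`, for
every `w : E4 → ℝ`, with `p = dw`, `u = p(m)`, `v = p(k)` the frame functionals of
`KerrNullFrame.lean` and `H_ℓ = ∂_{ℓ♯}H = M(Σ − 2r²)/Σ²`,
`K^{ℓ♯} = (r/Σ) u v + H_ℓ v²`.
The three pieces of the coordinate formula are `𝒟(p, p)` (`Kerr.sum_A_mul_sum_fderiv_nullVector_mul`),
`−½ (2r/Σ) g⁻¹(p, p) = −(r/Σ)(−uv + |p̸|²)` and `−½ (∂_{ℓ♯} g⁻¹)(p, p) = H_ℓ v²` (geodesy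
`∂_{ℓ♯}ℓ♯ = 0`); by shear-freeness `𝒟(p, p) = (r/Σ)|p̸|²` (`Kerr.nullShear_eq`) the angular
squares cancel. In particular `K^{ℓ♯}` has no `u²` and no `|p̸|²` term, and the coefficient of
`v² = (kψ)²` is `H_ℓ = −M(r² − a² cos²θ)/Σ² < 0` for `r > |a|`: for the future-directed ingoing
null vector `k = −ℓ♯` this is the positive red-shift coefficient `−H_ℓ (kψ)²` of `K^k = −K^{ℓ♯}`
(Dafermos–Rodnianski arXiv:0811.0354, §3.3.2: `Ŷ = (1 − 2M/r)⁻¹ ∂_u`, for `a = 0` a multiple of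
`k`). [cite: DafermosRodnianski2008, §3.3.2] -/
theorem multiplierBulk_nullVector (M a : ℝ) (hx : 0 < radius a x) (w : E4 → ℝ) :
    KerrSchild.multiplierBulk (inverseMetric M a) (fun y μ ↦ nullVector a y μ) w x =
      radius a x / blSigma a (E4.spatial x) *
          (frameOut M a x (fun μ ↦ fderiv ℝ w x (E4.basisVector μ)) *
            frameIn a x (fun μ ↦ fderiv ℝ w x (E4.basisVector μ))) +
        fderiv ℝ (scalarH M a) x (nullVector a x) *
          frameIn a x (fun μ ↦ fderiv ℝ w x (E4.basisVector μ)) ^ 2 := by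
  -- name the covector `p = dw`
  obtain ⟨p, hp⟩ : ∃ p : Fin 4 → ℝ, ∀ β, fderiv ℝ w x (E4.basisVector β) = p β := ⟨_, fun _ ↦ rfl⟩
  have hpf : (fun μ ↦ fderiv ℝ w x (E4.basisVector μ)) = p := funext hp
  rw [hpf]
  simp only [KerrSchild.multiplierBulk, hp]
  -- piece 1: the shear form
  rw [sum_A_mul_sum_fderiv_nullVector_mul M a hx p, nullShear_eq hx p]
  -- piece 2: the expansion
  rw [sum_fderiv_nullVector_basisVector hx, sum_inverseMetric_mul_mul_self_eq_frame]
  -- piece 3: the derivative of `g⁻¹` along `ℓ♯`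
  have h3 : ∑ μ, nullVector a x μ * ∑ α, ∑ β,
      fderiv ℝ (fun y ↦ inverseMetric M a y α β) x (E4.basisVector μ) * p α * p β =
      -2 * fderiv ℝ (scalarH M a) x (nullVector a x) * frameIn a x p ^ 2 := by
    have hswap : ∑ μ, nullVector a x μ * ∑ α, ∑ β,
        fderiv ℝ (fun y ↦ inverseMetric M a y α β) x (E4.basisVector μ) * p α * p β =
        ∑ α, ∑ β, (∑ μ, nullVector a x μ *
          fderiv ℝ (fun y ↦ inverseMetric M a y α β) x (E4.basisVector μ)) * p α * p β := by
      simp only [Finset.mul_sum, Finset.sum_mul]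
      rw [Finset.sum_comm]
      refine Finset.sum_congr rfl fun α _ ↦ ?_
      rw [Finset.sum_comm]
      exact Finset.sum_congr rfl fun β _ ↦ Finset.sum_congr rfl fun μ _ ↦ by ring
    rw [hswap]
    simp only [sum_nullVector_mul_fderiv_basisVector]
    rw [sum_sum_fderiv_inverseMetric_mul_mul M a hx (nullVector a x) p]
    simp only [fderiv_nullVector_apply_nullVector hx, zero_mul, Finset.sum_const_zero, mul_zero,
      add_zero]
  rw [h3]
  ring

/-! ### Axial invariance in derivative form: `∂_Φ F = 0` for rotation-invariant `F` -/

/-- The coordinate functions are differentiable with derivative the projection `dx^μ` (local copy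
of `KerrSchild.hasFDerivAt_coord` of `MinkowskiRadialMultiplier.lean`, not imported here).
[folklore] -/
private theorem hasFDerivAt_coord (μ : Fin 4) (x : E4) :
    HasFDerivAt (fun y : E4 ↦ y μ) (E4.dx μ) x :=
  (E4.dx μ).hasFDerivAt

/-- Components of `Φ = x₁ ∂₂ − x₂ ∂₁`: `Φ¹ = −x₂`. [folklore] -/
@[simp]
theorem axialVector_apply_one (x : E4) : axialVector x 1 = -x 2 := by
  simp [axialVector, E4.basisVector]

/-- Components of `Φ = x₁ ∂₂ − x₂ ∂₁`: `Φ² = x₁`. [folklore] -/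
@[simp]
theorem axialVector_apply_two (x : E4) : axialVector x 2 = x 1 := by
  simp [axialVector, E4.basisVector]

/-- Components of `Φ = x₁ ∂₂ − x₂ ∂₁`: `Φ³ = 0`. [folklore] -/
@[simp]
theorem axialVector_apply_three (x : E4) : axialVector x 3 = 0 := by
  simp [axialVector, E4.basisVector]

/-- The rotation orbit through `x`, affinely in `(cos α, sin α)`:
`R_α x = x + (cos α − 1)(x₁ ∂₁ + x₂ ∂₂) + sin α · Φ(x)`. [folklore] -/
theorem axialRotation_eq (α : ℝ) (x : E4) :
    E4.axialRotation α x =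
      x + ((Real.cos α - 1) • ((x 1) • E4.basisVector 1 + (x 2) • E4.basisVector 2) +
        Real.sin α • axialVector x) := by
  ext i
  fin_cases i <;> simp [axialVector, E4.basisVector] <;> ring

/-- **The axial Killing field is the velocity of the rotations**: `d/dα R_α x |_{α=0} = Φ(x)`.
[cite: ONeill1995, Ch. 2 §2.2] -/
theorem hasDerivAt_axialRotation (x : E4) :
    HasDerivAt (fun α : ℝ ↦ E4.axialRotation α x) (axialVector x) 0 := by
  have h1 : HasDerivAt (fun α : ℝ ↦
      (Real.cos α - 1) • ((x 1) • E4.basisVector 1 + (x 2) • E4.basisVector 2 : E4))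
      ((-Real.sin 0) • ((x 1) • E4.basisVector 1 + (x 2) • E4.basisVector 2)) 0 :=
    ((Real.hasDerivAt_cos 0).sub_const 1).smul_const _
  have h2 : HasDerivAt (fun α : ℝ ↦ Real.sin α • axialVector x) (Real.cos 0 • axialVector x) 0 :=
    (Real.hasDerivAt_sin 0).smul_const _
  have h := (h1.add h2).const_add x
  simp only [Real.sin_zero, neg_zero, zero_smul, Real.cos_zero, one_smul, zero_add] at h
  refine h.congr_of_eventuallyEq (Eventually.of_forall fun α ↦ ?_)
  exact axialRotation_eq α x

/-- **`∂_Φ F = 0` for every rotation-invariant `F`** differentiable at the point (chain rule along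
the orbit `α ↦ R_α x`). [cite: ONeill1995, Ch. 2 §2.2] -/
theorem fderiv_axialVector_eq_zero_of_invariant {F : E4 → ℝ}
    (hF : ∀ (α : ℝ) (y : E4), F (E4.axialRotation α y) = F y) (hd : DifferentiableAt ℝ F x) :
    fderiv ℝ F x (axialVector x) = 0 := by
  have hd' : HasFDerivAt F (fderiv ℝ F x) (E4.axialRotation 0 x) := by
    rw [E4.axialRotation_zero_apply]; exact hd.hasFDerivAt
  have h1 : HasDerivAt (fun α : ℝ ↦ F (E4.axialRotation α x)) (fderiv ℝ F x (axialVector x)) 0 :=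
    hd'.comp_hasDerivAt (0 : ℝ) (hasDerivAt_axialRotation x)
  have h2 : HasDerivAt (fun α : ℝ ↦ F (E4.axialRotation α x)) 0 0 := by
    have : (fun α : ℝ ↦ F (E4.axialRotation α x)) = fun _ ↦ F x := funext fun α ↦ hF α x
    rw [this]
    exact hasDerivAt_const 0 _
  exact h1.unique h2

/-- `∂_Φ r = 0` (the Kerr–Schild radius is axisymmetric). [cite: arXiv07060622, (35)] -/
theorem fderiv_radius_axialVector (hx : 0 < radius a x) :
    fderiv ℝ (radius a) x (axialVector x) = 0 :=
  fderiv_axialVector_eq_zero_of_invariant (fun α y ↦ radius_axialRotation a α y)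
    ((contDiffAt_radius hx (n := 1)).differentiableAt one_ne_zero)

/-- `∂_Φ H = 0` (the Kerr–Schild scalar is axisymmetric). [cite: arXiv07060622, (33)] -/
theorem fderiv_scalarH_axialVector (M a : ℝ) (hx : 0 < radius a x) :
    fderiv ℝ (scalarH M a) x (axialVector x) = 0 :=
  fderiv_axialVector_eq_zero_of_invariant (fun α y ↦ scalarH_axialRotation M a α y)
    ((contDiffAt_scalarH M a hx (n := 1)).differentiableAt one_ne_zero)

/-- **`∂_Φ ℓ♯ = Φ(ℓ♯)`**: the null vector is equivariant, so its derivative along the axial field is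
the infinitesimal rotation of its value, `∂_Φ (ℓ♯)^μ = Φ(ℓ♯(x))^μ = (0, −ℓ₂, ℓ₁, 0)^μ`.
[cite: KerrSchild1965, §2] -/
theorem fderiv_nullVector_apply_axialVector (hx : 0 < radius a x) (μ : Fin 4) :
    fderiv ℝ (fun y ↦ nullVector a y μ) x (axialVector x) = axialVector (nullVector a x) μ := by
  have hd : DifferentiableAt ℝ (fun y ↦ nullVector a y μ) x :=
    (contDiffAt_nullVector_apply a hx (n := 1) μ).differentiableAt one_ne_zero
  have hd' : HasFDerivAt (fun y ↦ nullVector a y μ) (fderiv ℝ (fun y ↦ nullVector a y μ) x)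
      (E4.axialRotation 0 x) := by
    rw [E4.axialRotation_zero_apply]; exact hd.hasFDerivAt
  have h1 : HasDerivAt ((fun y ↦ nullVector a y μ) ∘ fun α : ℝ ↦ E4.axialRotation α x)
      (fderiv ℝ (fun y ↦ nullVector a y μ) x (axialVector x)) 0 :=
    hd'.comp_hasDerivAt (0 : ℝ) (hasDerivAt_axialRotation x)
  have h2 : HasDerivAt ((fun y ↦ nullVector a y μ) ∘ fun α : ℝ ↦ E4.axialRotation α x)
      (axialVector (nullVector a x) μ) 0 := by
    have hfun : ((fun y ↦ nullVector a y μ) ∘ fun α : ℝ ↦ E4.axialRotation α x) =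
        (fun y : E4 ↦ y μ) ∘ fun α ↦ E4.axialRotation α (nullVector a x) :=
      funext fun α ↦ by simp [nullVector_axialRotation]
    rw [hfun]
    exact (hasFDerivAt_coord μ _).comp_hasDerivAt (0 : ℝ)
      (hasDerivAt_axialRotation (nullVector a x))
  exact h1.unique h2

/-! ### Killing multipliers have no bulk: `K^Φ = 0`, `K^T = 0`, `K^K = 0` -/

/-- Linearity bookkeeping: `∑_μ V^μ ∂_μ F = ∂_V F`. [folklore] -/
theorem sum_mul_fderiv_basisVector (F : E4 → ℝ) (x V : E4) :
    ∑ μ, V μ * fderiv ℝ F x (E4.basisVector μ) = fderiv ℝ F x V := by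
  conv_rhs => rw [eq_sum_basisVector V]
  simp only [map_sum, map_smul, smul_eq_mul]

/-- `∂_μ^ν`: components of the coordinate basis vectors (local helper; cf. `Kerr.dx_basisVector`).
[folklore] -/
private theorem basisVector_apply (μ ν : Fin 4) : E4.basisVector μ ν = if ν = μ then 1 else 0 := by
  simp [E4.basisVector]

/-- The components of `Φ` are linear, with differential `Φ^β = x₁ δ^β_2 − x₂ δ^β_1 ↦
δ^β_2 dx¹ − δ^β_1 dx²`. [folklore] -/
theorem hasFDerivAt_axialVector_apply (x : E4) (β : Fin 4) :
    HasFDerivAt (fun y : E4 ↦ axialVector y β)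
      ((E4.basisVector 2 β) • E4.dx 1 - (E4.basisVector 1 β) • E4.dx 2) x := by
  have h := ((hasFDerivAt_coord 1 x).mul_const (E4.basisVector 2 β)).sub
    ((hasFDerivAt_coord 2 x).mul_const (E4.basisVector 1 β))
  refine h.congr_of_eventuallyEq (Eventually.of_forall fun y ↦ ?_)
  simp only [axialVector, PiLp.sub_apply, PiLp.smul_apply, smul_eq_mul, Pi.sub_apply]

/-- The components of `Φ` are linear: `∂_v Φ^β(y) = Φ(v)^β`. [folklore] -/
theorem fderiv_axialVector_apply (x v : E4) (β : Fin 4) :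
    fderiv ℝ (fun y ↦ axialVector y β) x v = axialVector v β := by
  rw [(hasFDerivAt_axialVector_apply x β).fderiv]
  show E4.basisVector 2 β • E4.dx 1 v - E4.basisVector 1 β • E4.dx 2 v = axialVector v β
  rw [show E4.dx 1 v = v 1 from rfl, show E4.dx 2 v = v 2 from rfl]
  simp only [axialVector, PiLp.sub_apply, PiLp.smul_apply, smul_eq_mul]
  ring

/-- The components of `Φ` are differentiable. [folklore] -/
theorem differentiableAt_axialVector_apply (x : E4) (β : Fin 4) :
    DifferentiableAt ℝ (fun y ↦ axialVector y β) x :=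
  (hasFDerivAt_axialVector_apply x β).differentiableAt

/-- The raised covector in components: `A^μ = ∑_ν g^{μν} p_ν = η^{μμ} p_μ + 2H v (ℓ♯)^μ`
(`v = p(k)`). [folklore] -/
theorem sum_inverseMetric_mul_eq (M a : ℝ) (x : E4) (p : Fin 4 → ℝ) (μ : Fin 4) :
    ∑ ν, inverseMetric M a x μ ν * p ν =
      (if μ = 0 then -1 else 1) * p μ + 2 * scalarH M a x * frameIn a x p * nullVector a x μ := by
  rw [frameIn]
  simp only [inverseMetric_apply, sub_mul, Finset.sum_sub_distrib]
  have h1 : ∑ ν, (if μ = ν then (if μ = 0 then (-1 : ℝ) else 1) else 0) * p ν =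
      (if μ = 0 then -1 else 1) * p μ := by
    rw [Finset.sum_eq_single μ (fun ν _ hν ↦ by rw [if_neg (Ne.symm hν), zero_mul])
      (fun h ↦ (h (Finset.mem_univ μ)).elim), if_pos rfl]
  rw [h1]
  simp only [mul_assoc, ← Finset.mul_sum]
  have h2 : ∑ ν, nullVector a x ν * (nullVector a x μ * p ν) =
      nullVector a x μ * ∑ ν, nullVector a x ν * p ν := by
    rw [Finset.mul_sum]; exact Finset.sum_congr rfl fun ν _ ↦ by ring
  rw [h2]
  ring

/-- **`K^Φ = 0`**: the axial Killing field `Φ = x₁∂₂ − x₂∂₁` has no bulk term, at every point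
with `r > 0` (infinitesimal axisymmetry of `g⁻¹`: `∂_Φ g^{αβ} p_α p_β = 4H v p(Φ(ℓ♯))`, against
`∑_μ A^μ ∂_μΦ^β p_β = A¹p₂ − A²p₁`; `div Φ = 0`). DRSR arXiv:1402.7034, §2.2.2 (`Φ` is Killing).
[cite: DafermosRodnianskiShlapentokhrothman2014, §2.2.2] -/
theorem multiplierBulk_axialVector (M a : ℝ) (hx : 0 < radius a x) (w : E4 → ℝ) :
    KerrSchild.multiplierBulk (inverseMetric M a) (fun y μ ↦ axialVector y μ) w x = 0 := by
  obtain ⟨p, hp⟩ : ∃ p : Fin 4 → ℝ, ∀ β, fderiv ℝ w x (E4.basisVector β) = p β := ⟨_, fun _ ↦ rfl⟩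
  simp only [KerrSchild.multiplierBulk, hp, fderiv_axialVector_apply]
  -- piece 3: `∑_μ Φ^μ ∂_μ g^{αβ} = ∂_Φ g^{αβ}`
  have h3 : ∑ μ, axialVector x μ * ∑ α, ∑ β,
      fderiv ℝ (fun y ↦ inverseMetric M a y α β) x (E4.basisVector μ) * p α * p β =
      4 * scalarH M a x * frameIn a x p * ∑ α, axialVector (nullVector a x) α * p α := by
    have hswap : ∑ μ, axialVector x μ * ∑ α, ∑ β,
        fderiv ℝ (fun y ↦ inverseMetric M a y α β) x (E4.basisVector μ) * p α * p β =
        ∑ α, ∑ β, (∑ μ, axialVector x μ *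
          fderiv ℝ (fun y ↦ inverseMetric M a y α β) x (E4.basisVector μ)) * p α * p β := by
      simp only [Finset.mul_sum, Finset.sum_mul]
      rw [Finset.sum_comm]
      refine Finset.sum_congr rfl fun α _ ↦ ?_
      rw [Finset.sum_comm]
      exact Finset.sum_congr rfl fun β _ ↦ Finset.sum_congr rfl fun μ _ ↦ by ring
    rw [hswap]
    simp only [sum_mul_fderiv_basisVector]
    rw [sum_sum_fderiv_inverseMetric_mul_mul M a hx (axialVector x) p,
      fderiv_scalarH_axialVector M a hx]
    simp only [fderiv_nullVector_apply_axialVector hx]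
    ring
  rw [h3]
  simp only [sum_inverseMetric_mul_eq]
  simp only [Fin.sum_univ_four, Fin.isValue, axialVector_apply_zero, axialVector_apply_one,
    axialVector_apply_two, axialVector_apply_three, basisVector_apply]
  simp only [show (1 : Fin 4) ≠ 0 from by decide, show (2 : Fin 4) ≠ 0 from by decide,
    show (3 : Fin 4) ≠ 0 from by decide, show (1 : Fin 4) ≠ 2 from by decide,
    show (1 : Fin 4) ≠ 3 from by decide, show (2 : Fin 4) ≠ 1 from by decide,
    show (2 : Fin 4) ≠ 3 from by decide, if_true, if_false]
  ring

/-- **`K^T = 0`**: the stationary Killing field `T = ∂_{t*}` has no bulk term, at every point with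
`r > 0` (`∂T = 0` and `∂_{t*} g⁻¹ = 0`). DRSR arXiv:1402.7034, §2.2.2 (`T` is Killing).
[cite: DafermosRodnianskiShlapentokhrothman2014, §2.2.2] -/
theorem multiplierBulk_timeTranslation (M a : ℝ) (hx : 0 < radius a x) (w : E4 → ℝ) :
    KerrSchild.multiplierBulk (inverseMetric M a) (fun _ μ ↦ E4.basisVector 0 μ) w x = 0 := by
  rw [KerrSchild.multiplierBulk_of_fderiv_eq_zero _ _ (fun α ↦ by simp)]
  simp [Fin.sum_univ_four, E4.basisVector, fderiv_inverseMetric_basisVector_zero M a hx]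

/-- Components of the Hawking vector: `K^μ = δ^μ_0 + ω₊ Φ^μ`. [folklore] -/
theorem hawkingVector_apply (M a : ℝ) (x : E4) (μ : Fin 4) :
    hawkingVector M a x μ = E4.basisVector 0 μ + horizonAngularVelocity M a * axialVector x μ := by
  simp [hawkingVector, smul_eq_mul]

/-- The components of `K` are affine: differentiable everywhere. [folklore] -/
theorem differentiableAt_hawkingVector_apply (M a : ℝ) (x : E4) (μ : Fin 4) :
    DifferentiableAt ℝ (fun y ↦ hawkingVector M a y μ) x := by
  have h : (fun y ↦ hawkingVector M a y μ) =
      fun y ↦ E4.basisVector 0 μ + horizonAngularVelocity M a * axialVector y μ :=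
    funext fun y ↦ hawkingVector_apply M a y μ
  rw [h]
  exact (differentiableAt_const _).add ((differentiableAt_axialVector_apply x μ).const_mul _)

/-- **`K^K = 0` for the Hawking Killing field `K = T + ω₊ Φ`** (`Kerr.hawkingVector`), at every
point with `r > 0`: `K^K = K^T + ω₊ K^Φ = 0`. This is the input "`V` is Killing" of
Dafermos–Rodnianski, arXiv:0811.0354, Thm. 7.1, for the Kerr horizon generator (DRSR
arXiv:1402.7034, §2.2.2). [cite: DafermosRodnianskiShlapentokhrothman2014, §2.2.2] -/
theorem multiplierBulk_hawkingVector (M a : ℝ) (hx : 0 < radius a x) (w : E4 → ℝ) :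
    KerrSchild.multiplierBulk (inverseMetric M a) (fun y μ ↦ hawkingVector M a y μ) w x = 0 := by
  have hsplit : (fun y μ ↦ hawkingVector M a y μ) =
      (fun (_ : E4) μ ↦ E4.basisVector 0 μ) +
        fun y μ ↦ (fun _ : E4 ↦ horizonAngularVelocity M a) y * axialVector y μ := by
    funext y μ
    rw [Pi.add_apply, Pi.add_apply, hawkingVector_apply]
  rw [hsplit, KerrSchild.multiplierBulk_add (inverseMetric M a)
    (X := fun (_ : E4) μ ↦ E4.basisVector 0 μ)
    (Y := fun y μ ↦ (fun _ : E4 ↦ horizonAngularVelocity M a) y * axialVector y μ) w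
    (fun _ ↦ differentiableAt_const _)
    (fun μ ↦ (differentiableAt_const _).mul (differentiableAt_axialVector_apply x μ)),
    multiplierBulk_timeTranslation M a hx,
    KerrSchild.multiplierBulk_smul (inverseMetric M a) (f := fun _ : E4 ↦ horizonAngularVelocity M a)
      (X := fun y μ ↦ axialVector y μ) w (differentiableAt_const _)
      (differentiableAt_axialVector_apply x),
    multiplierBulk_axialVector M a hx]
  simp

/-! ### The red-shift multiplier `N = (1 + h₁(r − r₊)) K + (1 + f₁(r − r₊)) k` and its bulk -/

/-- The components `(dr)_μ = ∂_μ r` of the differential of the Kerr–Schild radius. [folklore] -/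
def dRadius (a : ℝ) (x : E4) : Fin 4 → ℝ := fun μ ↦ fderiv ℝ (radius a) x (E4.basisVector μ)

/-- Unfolding lemma for `dRadius`. [folklore] -/
theorem dRadius_apply (a : ℝ) (x : E4) (μ : Fin 4) :
    dRadius a x μ = fderiv ℝ (radius a) x (E4.basisVector μ) := rfl

/-- The **`K`-component** `p(K) = ∑_μ K^μ p_μ = p₀ + ω₊ (x₁ p₂ − x₂ p₁)` of a covector `p`
(`K = T + ω₊Φ` the Hawking vector; for `p = dψ` this is `Kψ`). [folklore] -/
def hawkingComp (M a : ℝ) (x : E4) (p : Fin 4 → ℝ) : ℝ := ∑ μ, hawkingVector M a x μ * p μ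

/-- `p(K) = p₀ + ω₊ (x₁ p₂ − x₂ p₁)` written out. [folklore] -/
theorem hawkingComp_eq (M a : ℝ) (x : E4) (p : Fin 4 → ℝ) :
    hawkingComp M a x p = p 0 + horizonAngularVelocity M a * (x 1 * p 2 - x 2 * p 1) := by
  simp only [hawkingComp, hawkingVector_apply, Fin.sum_univ_four, Fin.isValue, basisVector_apply,
    axialVector_apply_zero, axialVector_apply_one, axialVector_apply_two, axialVector_apply_three]
  simp only [show (1 : Fin 4) ≠ 0 from by decide, show (2 : Fin 4) ≠ 0 from by decide,
    show (3 : Fin 4) ≠ 0 from by decide, if_true, if_false]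
  ring

/-- The **raised pairing with `dr`**: `g⁻¹(p, dr) = ∑_μ A^μ ∂_μ r`, `A^μ = ∑_ν g^{μν} p_ν`
(for `p = dψ`: `∇r · ∇ψ`). [folklore] -/
def raisedDotRadius (M a : ℝ) (x : E4) (p : Fin 4 → ℝ) : ℝ :=
  ∑ μ, (∑ ν, inverseMetric M a x μ ν * p ν) * dRadius a x μ

/-- **Frame form of `g⁻¹(p, dr)`**: `= ½ u − ½ (1 − 2H) v + p̸·∇̸r`
(`Kerr.sum_A_mul_fderiv_radius`). [cite: arXiv07060622, (35)] -/
theorem raisedDotRadius_eq_frame (M a : ℝ) (hx : 0 < radius a x) (p : Fin 4 → ℝ) :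
    raisedDotRadius M a x p =
      2⁻¹ * frameOut M a x p - (1 - 2 * scalarH M a x) / 2 * frameIn a x p +
        frameAng a x p (dRadius a x) :=
  sum_A_mul_fderiv_radius M a hx p

/-- `K(r) = 0`: the Hawking vector is tangent to the level sets of `r` (`∂_{t*} r = ∂_Φ r = 0`).
[folklore] -/
theorem sum_hawkingVector_mul_dRadius (M a : ℝ) (hx : 0 < radius a x) :
    ∑ μ, hawkingVector M a x μ * dRadius a x μ = 0 := by
  simp only [dRadius_apply, sum_mul_fderiv_basisVector]
  have h : hawkingVector M a x = E4.basisVector 0 + horizonAngularVelocity M a • axialVector x := rfl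
  rw [h, map_add, map_smul, fderiv_radius_basisVector_zero a hx, fderiv_radius_axialVector hx,
    smul_zero, add_zero]

/-- `ℓ♯(r) = 1` in components: `∑_μ (ℓ♯)^μ ∂_μ r = 1`. [cite: arXiv07060622, (35)] -/
theorem sum_nullVector_mul_dRadius (hx : 0 < radius a x) :
    ∑ μ, nullVector a x μ * dRadius a x μ = 1 := by
  simp only [dRadius_apply, sum_nullVector_mul_fderiv_basisVector, fderiv_radius_nullVector hx]

/-- **The red-shift multiplier** near the Kerr horizon, as components in the Kerr–Schild chart:
`N = (1 + h₁ (r − r₊)) K + (1 + f₁ (r − r₊)) k`, `K = T + ω₊Φ` the Hawking Killing field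
(`Kerr.hawkingVector`), `k = −ℓ♯` the future-directed ingoing principal null vector, `h₁, f₁` real
parameters. This is the Kerr transcription of the explicit Schwarzschild recipe of
Dafermos–Rodnianski, arXiv:0811.0354, §3.3.2 (`N = T + Y`, `Y = (1 + δ₁(r − 2M))Ŷ + δ₂(r − 2M)T`,
`Ŷ ∥ k`), i.e. of the vector field of DRSR arXiv:1402.7034, Prop. 4.5.1 near `𝓗⁺` (before
cut-off and normalisation). [cite: DafermosRodnianski2008, §3.3.2] -/
def redShiftVector (M a h₁ f₁ : ℝ) (y : E4) (μ : Fin 4) : ℝ :=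
  (1 + h₁ * (radius a y - rPlus M a)) * hawkingVector M a y μ +
    -(1 + f₁ * (radius a y - rPlus M a)) * nullVector a y μ

/-- The affine-in-`r` profiles `c + k (r − r₊)` are differentiable where `r > 0`, with differential
`k dr`. [folklore] -/
theorem hasFDerivAt_affine_radius (M : ℝ) (hx : 0 < radius a x) (c k : ℝ) :
    HasFDerivAt (fun y ↦ c + k * (radius a y - rPlus M a)) (k • fderiv ℝ (radius a) x) x := by
  have hr : HasFDerivAt (radius a) (fderiv ℝ (radius a) x) x :=
    ((contDiffAt_radius hx (n := 1)).differentiableAt one_ne_zero).hasFDerivAt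
  have h := ((hr.sub_const (rPlus M a)).const_mul k).const_add c
  simpa using h

/-- **The bulk term of the red-shift multiplier, exactly.** At a point with `r > 0`, for every
`w : E4 → ℝ`, with `p = dw` and the frame functionals `u = p(m)`, `v = p(k)`:
`K^N = h₁ g⁻¹(p, dr) p(K) + f₁ (g⁻¹(p, dr) v + ½ g⁻¹(p, p)) − (1 + f₁(r − r₊)) ((r/Σ) u v + (∂_{ℓ♯}H) v²)`.
Proof: `K^{fX} = f K^X + g⁻¹(p, df) p(X) − ½ X(f) g⁻¹(p, p)` (`KerrSchild.multiplierBulk_smul`) for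
the two pieces, with `K^K = 0` (`Kerr.multiplierBulk_hawkingVector`), `K(r) = 0`,
`K^{ℓ♯} = (r/Σ)uv + (∂_{ℓ♯}H)v²` (`Kerr.multiplierBulk_nullVector`), `ℓ♯(r) = 1`, `p(ℓ♯) = −v`.
(Dafermos–Rodnianski arXiv:0811.0354, §3.3.2; DRSR arXiv:1402.7034, Prop. 4.5.1.)
[cite: DafermosRodnianskiShlapentokhrothman2014, Prop. 4.5.1] -/
theorem multiplierBulk_redShiftVector (M a h₁ f₁ : ℝ) (hx : 0 < radius a x) (w : E4 → ℝ) :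
    KerrSchild.multiplierBulk (inverseMetric M a) (redShiftVector M a h₁ f₁) w x =
      h₁ * raisedDotRadius M a x (fun μ ↦ fderiv ℝ w x (E4.basisVector μ)) *
          hawkingComp M a x (fun μ ↦ fderiv ℝ w x (E4.basisVector μ)) +
        f₁ * (raisedDotRadius M a x (fun μ ↦ fderiv ℝ w x (E4.basisVector μ)) *
            frameIn a x (fun μ ↦ fderiv ℝ w x (E4.basisVector μ)) +
          2⁻¹ * ∑ α, ∑ β, inverseMetric M a x α β *
            fderiv ℝ w x (E4.basisVector α) * fderiv ℝ w x (E4.basisVector β)) -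
        (1 + f₁ * (radius a x - rPlus M a)) *
          (radius a x / blSigma a (E4.spatial x) *
              (frameOut M a x (fun μ ↦ fderiv ℝ w x (E4.basisVector μ)) *
                frameIn a x (fun μ ↦ fderiv ℝ w x (E4.basisVector μ))) +
            fderiv ℝ (scalarH M a) x (nullVector a x) *
              frameIn a x (fun μ ↦ fderiv ℝ w x (E4.basisVector μ)) ^ 2) := by
  -- differentiability of the pieces
  have hh := hasFDerivAt_affine_radius (a := a) M hx 1 h₁
  have hf := hasFDerivAt_affine_radius (a := a) M hx 1 f₁
  have hK := differentiableAt_hawkingVector_apply M a x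
  have hℓ : ∀ μ, DifferentiableAt ℝ (fun y ↦ nullVector a y μ) x := fun μ ↦
    (contDiffAt_nullVector_apply a hx (n := 1) μ).differentiableAt one_ne_zero
  have hnf : DifferentiableAt ℝ (fun y ↦ -(1 + f₁ * (radius a y - rPlus M a))) x :=
    hf.differentiableAt.neg
  -- split `N = (1 + h) K + (−(1 + f)) ℓ♯`
  have hsplit : redShiftVector M a h₁ f₁ =
      (fun y μ ↦ (1 + h₁ * (radius a y - rPlus M a)) * hawkingVector M a y μ) +
        fun y μ ↦ -(1 + f₁ * (radius a y - rPlus M a)) * nullVector a y μ := by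
    funext y μ; rfl
  rw [hsplit, KerrSchild.multiplierBulk_add (inverseMetric M a)
    (X := fun y μ ↦ (1 + h₁ * (radius a y - rPlus M a)) * hawkingVector M a y μ)
    (Y := fun y μ ↦ -(1 + f₁ * (radius a y - rPlus M a)) * nullVector a y μ) w
    (fun μ ↦ hh.differentiableAt.mul (hK μ)) (fun μ ↦ hnf.mul (hℓ μ)),
    KerrSchild.multiplierBulk_smul (inverseMetric M a)
      (f := fun y ↦ 1 + h₁ * (radius a y - rPlus M a)) (X := fun y μ ↦ hawkingVector M a y μ) w
      hh.differentiableAt hK,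
    KerrSchild.multiplierBulk_smul (inverseMetric M a)
      (f := fun y ↦ -(1 + f₁ * (radius a y - rPlus M a))) (X := fun y μ ↦ nullVector a y μ) w
      hnf hℓ,
    multiplierBulk_hawkingVector M a hx, multiplierBulk_nullVector M a hx]
  -- the differentials of the profiles
  have hdh : ∀ v, fderiv ℝ (fun y ↦ 1 + h₁ * (radius a y - rPlus M a)) x v =
      h₁ * fderiv ℝ (radius a) x v := fun v ↦ by
    rw [hh.fderiv]; rfl
  have hnf' : HasFDerivAt (fun y ↦ -(1 + f₁ * (radius a y - rPlus M a)))
      (-(f₁ • fderiv ℝ (radius a) x)) x := hf.neg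
  have hdf : ∀ v, fderiv ℝ (fun y ↦ -(1 + f₁ * (radius a y - rPlus M a))) x v =
      -(f₁ * fderiv ℝ (radius a) x v) := fun v ↦ by
    rw [hnf'.fderiv]; rfl
  simp only [hdh, hdf]
  -- name the covector `p = dw`
  obtain ⟨p, hp⟩ : ∃ p : Fin 4 → ℝ, ∀ β, fderiv ℝ w x (E4.basisVector β) = p β := ⟨_, fun _ ↦ rfl⟩
  have hpf : (fun μ ↦ fderiv ℝ w x (E4.basisVector μ)) = p := funext hp
  rw [hpf]
  simp only [hp]
  -- collect: `∑ A^μ (k ∂_μ r) = k g⁻¹(p, dr)`, `X(r)`, `p(X)`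
  have e1 : ∑ μ, (∑ ν, inverseMetric M a x μ ν * p ν) * (h₁ * fderiv ℝ (radius a) x (E4.basisVector μ)) =
      h₁ * raisedDotRadius M a x p := by
    rw [raisedDotRadius, Finset.mul_sum]
    exact Finset.sum_congr rfl fun μ _ ↦ by rw [dRadius_apply]; ring
  have e2 : ∑ μ, (∑ ν, inverseMetric M a x μ ν * p ν) * -(f₁ * fderiv ℝ (radius a) x (E4.basisVector μ)) =
      -(f₁ * raisedDotRadius M a x p) := by
    rw [raisedDotRadius, Finset.mul_sum, ← Finset.sum_neg_distrib]
    exact Finset.sum_congr rfl fun μ _ ↦ by rw [dRadius_apply]; ring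
  have e3 : ∑ μ, hawkingVector M a x μ * (h₁ * fderiv ℝ (radius a) x (E4.basisVector μ)) = 0 := by
    have h := sum_hawkingVector_mul_dRadius M a hx
    simp only [dRadius_apply] at h
    have h' : ∑ μ, hawkingVector M a x μ * (h₁ * fderiv ℝ (radius a) x (E4.basisVector μ)) =
        h₁ * ∑ μ, hawkingVector M a x μ * fderiv ℝ (radius a) x (E4.basisVector μ) := by
      rw [Finset.mul_sum]
      exact Finset.sum_congr rfl fun μ _ ↦ by ring
    rw [h', h, mul_zero]
  have e4 : ∑ μ, nullVector a x μ * -(f₁ * fderiv ℝ (radius a) x (E4.basisVector μ)) = -f₁ := by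
    have h := sum_nullVector_mul_dRadius hx
    simp only [dRadius_apply] at h
    have h' : ∑ μ, nullVector a x μ * -(f₁ * fderiv ℝ (radius a) x (E4.basisVector μ)) =
        -(f₁ * ∑ μ, nullVector a x μ * fderiv ℝ (radius a) x (E4.basisVector μ)) := by
      rw [Finset.mul_sum, ← Finset.sum_neg_distrib]
      exact Finset.sum_congr rfl fun μ _ ↦ by ring
    rw [h', h, mul_one]
  have e5 : ∑ α, hawkingVector M a x α * p α = hawkingComp M a x p := rfl
  rw [e1, e2, e3, e4, e5, sum_nullVector_mul_eq_neg_frameIn]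
  ring

/-! ### Frame identities: `|∇̸r|²`, `g⁻¹(dr, dr) = Δ/Σ`, and the `f₁`-terms as a square -/

/-- Bilinearity of the angular pairing in the first slot. [folklore] -/
theorem frameAng_add_smul_left (a : ℝ) (x : E4) (p q s : Fin 4 → ℝ) (c : ℝ) :
    frameAng a x (p + c • q) s = frameAng a x p s + c * frameAng a x q s := by
  simp only [frameAng, spatialDotNull, Pi.add_apply, Pi.smul_apply, smul_eq_mul, Fin.sum_univ_three]
  ring

/-- Expansion of the angular square: `|p̸ + c q̸|² = |p̸|² + 2c p̸·q̸ + c²|q̸|²`. [folklore] -/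
theorem frameAngSq_add_smul (a : ℝ) (x : E4) (p q : Fin 4 → ℝ) (c : ℝ) :
    frameAngSq a x (p + c • q) = frameAngSq a x p + 2 * c * frameAng a x p q + c ^ 2 * frameAngSq a x q := by
  simp only [frameAng, frameAngSq, spatialDotNull, Pi.add_apply, Pi.smul_apply, smul_eq_mul,
    Fin.sum_univ_three]
  ring

/-- `(dr)₀ = ∂_{t*} r = 0`. [folklore] -/
theorem dRadius_apply_zero (hx : 0 < radius a x) : dRadius a x 0 = 0 :=
  fderiv_radius_basisVector_zero a hx

/-- `dr(k) = −1` in the language of `dRadius`. [cite: arXiv07060622, (35)] -/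
theorem frameIn_dRadius (hx : 0 < radius a x) : frameIn a x (dRadius a x) = -1 :=
  frameIn_fderiv_radius hx

/-- `dr(m) = 1 − 2H` in the language of `dRadius`. [cite: arXiv07060622, (35)] -/
theorem frameOut_dRadius (M : ℝ) (hx : 0 < radius a x) :
    frameOut M a x (dRadius a x) = 1 - 2 * scalarH M a x :=
  frameOut_fderiv_radius M a hx

/-- `ℓ⃗·∇r = 1` (`= dr(ℓ♯)` since `∂_{t*} r = 0`). [cite: arXiv07060622, (35)] -/
theorem spatialDotNull_dRadius (hx : 0 < radius a x) : spatialDotNull a x (dRadius a x) = 1 := by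
  have h := frameIn_dRadius hx
  rw [frameIn_eq, dRadius_apply_zero hx] at h
  linarith

/-- **`|∇̸r|² = (r² + a² − Σ)/Σ`** (`= a² sin²θ/Σ`): the angular square of `dr`, from
`|∇r|² = (r² + a²)/Σ` and `ℓ⃗·∇r = 1`. [cite: arXiv07060622, (35)] -/
theorem frameAngSq_dRadius (hx : 0 < radius a x) :
    frameAngSq a x (dRadius a x) =
      (radius a x ^ 2 + a ^ 2 - blSigma a (E4.spatial x)) / blSigma a (E4.spatial x) := by
  have hS := blSigma_spatial_pos hx
  rw [frameAngSq, spatialDotNull_dRadius hx]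
  simp only [dRadius_apply, sum_sq_fderiv_radius hx]
  field_simp

/-- **`g⁻¹(dr, dr) = Δ/Σ`**, `Δ = r² − 2Mr + a²`: the level sets of `r` are timelike outside the
horizons, null on them. [cite: ONeill1995, Ch. 2 §2.5] -/
theorem raisedDotRadius_dRadius (M : ℝ) (hx : 0 < radius a x) :
    raisedDotRadius M a x (dRadius a x) =
      (radius a x ^ 2 - 2 * M * radius a x + a ^ 2) / blSigma a (E4.spatial x) := by
  have hS := blSigma_spatial_pos hx
  rw [raisedDotRadius_eq_frame M a hx, frameAng_self, frameAngSq_dRadius hx, frameOut_dRadius M hx,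
    frameIn_dRadius hx, scalarH_eq_div_blSigma M a hx]
  field_simp
  ring

/-- **The `f₁`-terms of `K^N` are a square up to `Δ`**:
`g⁻¹(p, dr) v + ½ g⁻¹(p, p) = ½ |p̸ + v ∇̸r|² − ½ (Δ/Σ) v²`, where `|p̸ + v∇̸r|²` is the angular
square of `p + v dr` — the angular norm adapted to the frame `{K, k}` of the horizon rather than
to `{m, k}`. On `𝓗⁺` (`Δ = 0`) it is a pure square. [folklore] -/
theorem raisedDotRadius_mul_frameIn_add (M : ℝ) (hx : 0 < radius a x) (p : Fin 4 → ℝ) :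
    raisedDotRadius M a x p * frameIn a x p + 2⁻¹ * ∑ α, ∑ β, inverseMetric M a x α β * p α * p β =
      2⁻¹ * frameAngSq a x (p + frameIn a x p • dRadius a x) -
        2⁻¹ * ((radius a x ^ 2 - 2 * M * radius a x + a ^ 2) / blSigma a (E4.spatial x)) *
          frameIn a x p ^ 2 := by
  rw [← raisedDotRadius_dRadius M hx, raisedDotRadius_eq_frame M a hx, raisedDotRadius_eq_frame M a hx,
    frameOut_dRadius M hx, frameIn_dRadius hx, frameAng_self, frameAngSq_add_smul,
    sum_inverseMetric_mul_mul_self_eq_frame]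
  ring

/-! ### On the horizon `r = r₊`: `dr♯ = 2H K`, `g⁻¹(dr, dr) = 0`, the red-shift coefficient -/

/-- On the horizon the mass is `M = (r₊² + a²)/(2r₊)` (`Δ(r₊) = 0`). [cite: ONeill1995, Ch. 2 §2.3] -/
theorem mass_eq_of_radius_eq_rPlus (hMa : |a| ≤ M) (hM : 0 < M) (hr : radius a x = rPlus M a) :
    M = (radius a x ^ 2 + a ^ 2) / (2 * radius a x) := by
  have hrp := rPlus_pos hM a
  have h := rPlus_sq_add_sq hMa
  rw [← hr] at h hrp
  field_simp
  linarith

/-- **`dr♯ = 2H K` on the horizon**, contracted with a covector: `g⁻¹(p, dr) = 2H p(K)` at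
every point with `r = r₊` (`|a| ≤ M`, `0 < M`). Componentwise: `∇r − 2Hℓ⃗ = 2Hω₊ (−x₂, x₁, 0)`
and `(dr♯)⁰ = 2H` at `r = r₊`; i.e. the normal `dr♯` of the null hypersurface `{r = r₊}` is the
null generator, with the factor `2H = 2Mr₊/Σ`. DRSR arXiv:1402.7034, §2.2.2 ("`K` is null and
normal to `𝓗⁺`"). [cite: DafermosRodnianskiShlapentokhrothman2014, §2.2.2] -/
theorem raisedDotRadius_of_radius_eq_rPlus (hMa : |a| ≤ M) (hM : 0 < M)
    (hr : radius a x = rPlus M a) (p : Fin 4 → ℝ) :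
    raisedDotRadius M a x p = 2 * scalarH M a x * hawkingComp M a x p := by
  have hx : 0 < radius a x := hr ▸ rPlus_pos hM a
  have hS := blSigma_spatial_pos hx
  have hQ : radius a x ^ 2 + a ^ 2 ≠ 0 := by positivity
  have hM' := mass_eq_of_radius_eq_rPlus hMa hM hr
  have hω : horizonAngularVelocity M a = a / (radius a x ^ 2 + a ^ 2) := by
    rw [horizonAngularVelocity, ← rPlus_sq_add_sq hMa, ← hr]
  -- expand everything in components
  rw [raisedDotRadius, hawkingComp_eq, hω]
  simp only [sum_inverseMetric_mul_eq]
  -- split off the term `2H v ∑_μ (ℓ♯)^μ ∂_μ r = 2H v` (this is where the quartic enters)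
  have hsplit : ∑ μ, ((if μ = 0 then -1 else 1) * p μ +
      2 * scalarH M a x * frameIn a x p * nullVector a x μ) * dRadius a x μ =
      ∑ μ, (if μ = 0 then -1 else 1) * p μ * dRadius a x μ +
        2 * scalarH M a x * frameIn a x p * ∑ μ, nullVector a x μ * dRadius a x μ := by
    rw [Finset.mul_sum, ← Finset.sum_add_distrib]
    exact Finset.sum_congr rfl fun μ _ ↦ by ring
  rw [hsplit, sum_nullVector_mul_dRadius hx, mul_one]
  simp only [frameIn_eq, spatialDotNull_eq, Fin.sum_univ_four, Fin.isValue,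
    dRadius_apply, fderiv_radius_basisVector_zero a hx, fderiv_radius_basisVector_one hx,
    fderiv_radius_basisVector_two hx, fderiv_radius_basisVector_three hx, nullCovectorFun_apply_one,
    nullCovectorFun_apply_two, nullCovectorFun_apply_three, scalarH_eq_div_blSigma M a hx]
  simp only [show (1 : Fin 4) ≠ 0 from by decide, show (2 : Fin 4) ≠ 0 from by decide,
    show (3 : Fin 4) ≠ 0 from by decide, if_true, if_false]
  rw [hM']
  field_simp
  ring

/-- **`g⁻¹(dr, dr) = 0` on the horizon** (`Δ(r₊) = 0`: `{r = r₊}` is a null hypersurface).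
[cite: ONeill1995, Ch. 2 §2.5] -/
theorem raisedDotRadius_dRadius_of_radius_eq_rPlus (hMa : |a| ≤ M) (hM : 0 < M)
    (hr : radius a x = rPlus M a) : raisedDotRadius M a x (dRadius a x) = 0 := by
  have hx : 0 < radius a x := hr ▸ rPlus_pos hM a
  have h := rPlus_sq_add_sq hMa
  rw [raisedDotRadius_dRadius M hx, ← hr] at *
  rw [show radius a x ^ 2 - 2 * M * radius a x + a ^ 2 = 0 by linarith, zero_div]

/-- **`1 − 2H = −|∇̸r|²` on the horizon** (so `0 < 2H`, `2H ≥ 1` there). [folklore] -/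
theorem one_sub_two_mul_scalarH_of_radius_eq_rPlus (hMa : |a| ≤ M) (hM : 0 < M)
    (hr : radius a x = rPlus M a) :
    1 - 2 * scalarH M a x = -frameAngSq a x (dRadius a x) := by
  have hx : 0 < radius a x := hr ▸ rPlus_pos hM a
  have hS := blSigma_spatial_pos hx
  have h0 := raisedDotRadius_dRadius_of_radius_eq_rPlus hMa hM hr
  rw [raisedDotRadius_eq_frame M a hx, frameOut_dRadius M hx, frameIn_dRadius hx, frameAng_self] at h0
  linarith

/-- **The red-shift coefficient on the horizon**:
`−∂_{ℓ♯}H − (r/Σ)|∇̸r|² = (r₊ − M)/Σ` at `r = r₊` — positive in the subextremal case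
(`r₊ − M = √(M² − a²)`), vanishing in the extremal case. Since `dr♯ = 2HK` and `dr(k) = −1` give
`g(K, k) = −1/(2H)`, this is `2H κ` with `κ = (r₊ − M)/(2Mr₊) = (r₊ − r₋)/(2(r₊² + a²))` the
surface gravity of the Kerr horizon (Dafermos–Rodnianski arXiv:0811.0354, Thm. 7.1: the red-shift
is positive iff `κ > 0`; DRSR arXiv:1402.7034, §2.2.2). [cite: DafermosRodnianski2008, Thm. 7.1] -/
theorem redShiftCoeff_of_radius_eq_rPlus (hMa : |a| ≤ M) (hM : 0 < M) (hr : radius a x = rPlus M a) :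
    -fderiv ℝ (scalarH M a) x (nullVector a x) -
        radius a x / blSigma a (E4.spatial x) * frameAngSq a x (dRadius a x) =
      (radius a x - M) / blSigma a (E4.spatial x) := by
  have hx : 0 < radius a x := hr ▸ rPlus_pos hM a
  have hS := blSigma_spatial_pos hx
  have h := rPlus_sq_add_sq hMa
  rw [← hr] at h
  rw [fderiv_scalarH_nullVector M hx, frameAngSq_dRadius hx]
  field_simp
  linear_combination (-radius a x) * h

/-- **The red-shift coefficient is `2H κ`**: `(r₊ − M)/Σ = 2H(x) · κ(M, a)` at `r = r₊`, with
`κ = √(M² − a²)/(r₊² + a²) = (r₊ − M)/(r₊² + a²)` the surface gravity of `KerrSurfaceGravity.lean`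
(`Kerr.surfaceGravity`) and `2H = 2Mr₊/Σ = −1/g(K, k)` the normalisation of the transversal null
vector `k` against the generator `K` at the point. This is the geometric meaning of `κ` on the
Kerr–Schild side: the `(kψ)²`-coefficient of the bulk of the transversal null multiplier on `𝓗⁺`
(Dafermos–Rodnianski arXiv:0811.0354, Thm. 7.1 and its proof, `π^Y(V, V) = 2κ`).
[cite: DafermosRodnianski2008, Thm. 7.1] -/
theorem redShiftCoeff_eq_surfaceGravity (hMa : |a| ≤ M) (hM : 0 < M) (hr : radius a x = rPlus M a) :
    (radius a x - M) / blSigma a (E4.spatial x) = 2 * scalarH M a x * surfaceGravity M a := by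
  have hx : 0 < radius a x := hr ▸ rPlus_pos hM a
  have hS := blSigma_spatial_pos hx
  have h := rPlus_sq_add_sq hMa
  rw [surfaceGravity_eq_rPlus_sub_div, ← hr] at *
  rw [scalarH_eq_div_blSigma M a hx, h]
  field_simp

/-- **`u = p(m)` on the horizon in terms of `p(K)`**: `u = 4H p(K) + |∇̸r|² v − 2 (p̸ + v∇̸r)·∇̸r`.
[folklore] -/
theorem frameOut_of_radius_eq_rPlus (hMa : |a| ≤ M) (hM : 0 < M) (hr : radius a x = rPlus M a)
    (p : Fin 4 → ℝ) :
    frameOut M a x p = 4 * scalarH M a x * hawkingComp M a x p +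
      frameAngSq a x (dRadius a x) * frameIn a x p -
        2 * frameAng a x (p + frameIn a x p • dRadius a x) (dRadius a x) := by
  have hx : 0 < radius a x := hr ▸ rPlus_pos hM a
  have h1 := raisedDotRadius_of_radius_eq_rPlus hMa hM hr p
  have h2 := one_sub_two_mul_scalarH_of_radius_eq_rPlus hMa hM hr
  rw [raisedDotRadius_eq_frame M a hx] at h1
  rw [frameAng_add_smul_left, frameAng_self]
  rw [h2] at h1
  linarith

/-! ### The horizon form of `K^N` -/

/-- **The bulk term of the red-shift multiplier on the horizon.** At a point with `r = r₊`
(`|a| ≤ M`, `0 < M`), for every `w`, with `p = dw`, `λ = p(K)`, `v = p(k)`, `q = p + v dr`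
(the covector with `q(k) = 0`, `q(K) = λ`, whose angular part `q̸ = p̸ + v∇̸r` is the part of `p`
orthogonal to the horizon frame `{K, k}`), `H = Mr₊/Σ`:
`K^N = 2H h₁ λ² + ½ f₁ |q̸|² + ((r₊ − M)/Σ) v² − (4Hr₊/Σ) λ v + (2r₊/Σ) v (q̸·∇̸r)`.
The `v²`-coefficient `(r₊ − M)/Σ > 0` is the red-shift (surface gravity `κ > 0`), the parameters
`h₁`, `f₁` buy the squares of the other two components, and the cross terms have bounded
coefficients (`|q̸·∇̸r| ≤ |q̸| |∇̸r|`, `|∇̸r|² = a² sin²θ/Σ`): this is the structure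
"`K^N ≥ b J^N_μ N^μ` on `𝓗⁺` for `σ` large" of Dafermos–Rodnianski, arXiv:0811.0354, Thm. 7.1
(with `Y ↦ k`, `V ↦ K`, `σ ↦ (f₁, h₁)`), for the Kerr horizon.
[cite: DafermosRodnianski2008, Thm. 7.1] -/
theorem multiplierBulk_redShiftVector_of_radius_eq_rPlus (h₁ f₁ : ℝ) (hMa : |a| ≤ M) (hM : 0 < M)
    (hr : radius a x = rPlus M a) (w : E4 → ℝ) :
    KerrSchild.multiplierBulk (inverseMetric M a) (redShiftVector M a h₁ f₁) w x =
      2 * scalarH M a x * h₁ * hawkingComp M a x (fun μ ↦ fderiv ℝ w x (E4.basisVector μ)) ^ 2 +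
        2⁻¹ * f₁ * frameAngSq a x ((fun μ ↦ fderiv ℝ w x (E4.basisVector μ)) +
          frameIn a x (fun μ ↦ fderiv ℝ w x (E4.basisVector μ)) • dRadius a x) +
        (radius a x - M) / blSigma a (E4.spatial x) *
          frameIn a x (fun μ ↦ fderiv ℝ w x (E4.basisVector μ)) ^ 2 -
        4 * scalarH M a x * radius a x / blSigma a (E4.spatial x) *
          hawkingComp M a x (fun μ ↦ fderiv ℝ w x (E4.basisVector μ)) *
            frameIn a x (fun μ ↦ fderiv ℝ w x (E4.basisVector μ)) +
        2 * radius a x / blSigma a (E4.spatial x) *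
          frameIn a x (fun μ ↦ fderiv ℝ w x (E4.basisVector μ)) *
            frameAng a x ((fun μ ↦ fderiv ℝ w x (E4.basisVector μ)) +
              frameIn a x (fun μ ↦ fderiv ℝ w x (E4.basisVector μ)) • dRadius a x) (dRadius a x) := by
  have hx : 0 < radius a x := hr ▸ rPlus_pos hM a
  have hS := blSigma_spatial_pos hx
  set p : Fin 4 → ℝ := fun μ ↦ fderiv ℝ w x (E4.basisVector μ) with hp_def
  have hΔ : radius a x ^ 2 - 2 * M * radius a x + a ^ 2 = 0 := by
    have h := rPlus_sq_add_sq hMa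
    rw [← hr] at h
    linarith
  have hc := redShiftCoeff_of_radius_eq_rPlus hMa hM hr
  rw [multiplierBulk_redShiftVector M a h₁ f₁ hx w, ← hp_def, raisedDotRadius_mul_frameIn_add M hx p,
    raisedDotRadius_of_radius_eq_rPlus hMa hM hr p, frameOut_of_radius_eq_rPlus hMa hM hr p, hr,
    sub_self, mul_zero, add_zero, ← hr, hΔ, zero_div]
  have hHl : fderiv ℝ (scalarH M a) x (nullVector a x) =
      -(radius a x - M) / blSigma a (E4.spatial x) -
        radius a x / blSigma a (E4.spatial x) * frameAngSq a x (dRadius a x) := by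
    rw [neg_div]
    linarith
  rw [hHl]
  ring

end Literature.Geometry.Lorentzian.Kerr

end
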